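import Literature.MathematicalPhysics.QuantumFieldTheory.Balaban1983to89.B8DentedCubeMemberCutoffsWall
import Literature.MathematicalPhysics.QuantumFieldTheory.Balaban1983to89.B8DentedCubeMemberBoxRowsL0
import Literature.MathematicalPhysics.QuantumFieldTheory.Balaban1983to89.B8Eq1101CubeMemberParametrixIdentity

/-!
# `Balaban1983to89.B8Eq1101DentedCubeMemberParametrixIdentity` — [Balaban1985RegularSpaces] (1.101) AT `U₀ = 1` ON THE DENTED CUBE MEMBER of
# [Balaban1985Variational] (148)–(150): THE TWO-REGION PARAMETRIX — ITS ROW IDENTITY `T·P u = u + K₁u` AND THE TWO REGION BOUNDS, at the dented L0 box member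
# (`D.lev = levD`) — dented twins of dag-n05-c's F4b `B8Eq1101CubeMemberParametrixIdentity` §§1–3

statement-level skeleton of published theorems with citation tags; proofs where landed; nothing here is a claim about the Yang–Mills mass gap

`[Balaban1984PropagatorsII]` ("B6", CMP **96** (1984) 223–250) p. 228, (2.47)–(2.58) p. 231–233 (the two-region parametrix and its commutators), Prop. 2.2 (2.67) p. 234;
`[Balaban1985RegularSpaces]` ("B8" = [6], CMP **99** (1985) 75–102) (1.101) p. 93, (1.91) p. 91, p. 98; `[Balaban1985BackgroundPropagators]` ([4], CMP **99** (1985) 389–434)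
Theorem 3.1 (3.42) p. 397, (3.47) p. 398; `[Balaban1985Variational]` ("[15]", CMP **102** (1985) 277–309) (148)–(151) p. 301.  PDF held:
`paper:balaban1985-cmp99-regular-spaces-gauge-fixing`, `paper:balaban1984-cmp96-propagators-rt-ii`, `paper:balaban1985-cmp102-variational-background`.

CITATION HEADER (lean-in-tree rule).  Cell `pub-ymgap` (YM Track A, HUMAN RULING D-0062), DAG node N05 = [B8], seat `pub-ymgap-dag-n05-e` (g32; FAN-OUT §N05 row s3b,
Proposition-6 lane; piece (d2-f) of the (β) road — the dented parametrix, file 2: g31 HANDOFF «Next 1 (iii)», dag-n05-c STANDING GO I.42366, this seat INTENT I.43617).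
WHY THIS FILE.  The last two named facts of the (β) crown (`Real1DentedCubeMemberPrinted`, `Real1M4DentedCubeMemberPrinted`, p669491) are [4] Theorem 3.1 ∕ [6] (1.101) for
`T⁻¹` on [15]'s dented sequence `{Ω′_j}`.  dag-n05-c proves the pure twins by the two-region parametrix of [B6] p. 228 ∕ (2.47) ff.: region A = p21's Neumann box (r05's
hypothesis-free (1.101)) read at the no-`Λ₀` member `cubeDomains`, region B = the Dirichlet wall (F3).  On the DENTED member the region-A box is the L0 dented member
`(cubeTDomainsDented … (boxP …) …).toDomains` (levels `0 … k` by `levD`; r03's `toDomains`), where the consumer's rows ARE p21's rows at every interior site of `□₀` (this seat's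
dented G2 `B8DentedCubeMemberBoxRowsL0.row_eq_mlOp_row`, p673619) — which also covers the `k = 1` dent at level `0`.  THIS FILE re-runs F4b §§1–3 there: the row identity, the
region-A input∕output bookkeeping (against any (1.101)-type package `hG` for `G′ = gml` at the member — r05's L0 `B8Ineq198MultiLevelBoxL0.ineq1101_multiLevelBox_two` in the
consumers), the region-B output (F3 `wall_rowBound` with file 1's dented wall structure).  F4b's structure-free lemmas (`mem_cube_one_of_cutA_ne_zero`, `parametrix_sup`, `abs_row_le`,
`card_filter_block_le`) are IMPORTED by name.

WHAT THIS FILE PROVES (kernel-checked; `L = ℓ + 1 ≥ 2`, `M_h ≥ 2`; `c : Node00.CubeB8D (d+1) (ℓ+1) K Ω`; `D : Domains d ℓ M_h c.k (boxP …) R` with `hD : D.lev = levD M_h c`;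
`S ↔ c.sq 0`; weights with `w_j·L^{−2(d+1)j} = η⁻²levC_j` for all `j ≤ k`).
* §1 ★★ `parametrix_identity` — `T·P u = u + K₁u` row by row on `□₀`.
* §2 ★ `regionA_bounds` — the region-A input in r05's `(−2)`-weighted currency on the dented tower (`levD`, `c.sq j`) and the output bounds from a package `hG`.
* §3 ★ `regionB_bound` — `|gB| ≤ (2L²∕a₀)·c₀((2(d+1)L)⁻¹)^{d+1}·N` on the wall.
HONEST SCOPE ∕ NOT CLAIMED.  Identities and bookkeeping; the estimates are p21∕r05's (region A, consumed as the hypothesis `hG`) and F3's (region B, USED by name); count-neutral;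
N05 ∕ N07 NOT discharged; one finite `T⁴` programme at fixed `ε`, Bałaban as printed; nothing continuum ∕ ℝ⁴ ∕ OS ∕ mass-gap ∕ Clay.  No `sorry`, no `def`, no `instance`, no
`notation`.  Unit `pub-ymgap-dag-n05-e` (g32), 2026-08-28.

RELATED IN THE TREE, NOT DUPLICATED (`rg -l 'Eq1101DentedCubeMember' Balaban1983to89` = 0, 2026-08-28T22:50Z): F4b `B8Eq1101CubeMemberParametrixIdentity` (dag-n05-c; the PURE model,
structure-free lemmas USED), F4a `B8Eq1101CubeMemberCutoffs` (cutoffs, wall — USED), F3 `B8Eq191FlatDirichletWall.wall_rowBound` (USED), `B8DentedCubeMemberCutoffsWall` ∕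
`B8DentedCubeMemberBoxRowsL0` ∕ `B8DentedCubeMemberBoxTowers` (g32; USED), p21 `B6MultiLevelBoxOperator.{gml, mlOp_mul_gml}` (USED).
-/
noncomputable section

namespace Literature.MathematicalPhysics.QuantumFieldTheory.Balaban1983to89.B8Eq1101DentedCubeMemberParametrixIdentity

open scoped Matrix
open B6MultiLevelBoxOperator (N0 mlOp gml levC)
open B4Reflection242 (boxDom mem_boxDom blk)
open B7Prop1Explicit (e)
open B8Eq131Cubes (l1dist cube cube_anti)
open B8Eq191FlatDirichletDepth (depth)
open B8Eq191FlatDirichletForm (isUnit_flatMatrix)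
open B8CubeMemberBoxDomains (shift boxP add_shift_sub_shift)
open B8CubeMemberBoxDomainsL0 (mem_boxDom_of_mem_cube_zero)
open B8CubeMemberTorusDomainsDented (levD levD_le)
open B8DentedCubeMemberBoxTowers (tower_iff_levD_eq mem_sq_of_tower)
open B8DentedCubeMemberBoxRowsL0 (row_eq_mlOp_row)
open B8DentedCubeMemberCutoffsWall (wall_hfull wall_hdisj wall_hcover wall_hlow)
open B8Eq1101CubeMemberCutoffs (cutA cutAt cutB cutBt wall cutAt_mul_cutA cutBt_mul_cutB cutA_add_cutB depth_of_cutAt_ne_zero cutBt_facts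
  mem_wall_of_depth_le wall_subset cut_mem cut_eq_zero_of_not_mem)
open B8Eq1101CubeMemberParametrixIdentity (mem_cube_one_of_cutA_ne_zero)
open B8Eq191FlatDirichletWall (wall_rowBound one_le_c0)
open B6Prop22DerivMultiLevelBox (dMat)
open Node00 (CubeB8D)
open Literature.MathematicalPhysics.QuantumLattice (blockMap)

variable {d : ℕ}

/-! ## §1 The identity `T·P u = u + K₁u` on `□₀` -/

open Classical in
/-- **THE PARAMETRIX IDENTITY, ROW BY ROW, ON THE DENTED MEMBER.**  Data: the dented cube member `c : CubeB8D` at the top truncation with the big-block side conditions, a box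
member `D` with `D.lev = levD` (the dented L0 member of record), weights `w` (nonnegative, `w_j·L^{−2(d+1)j} = η⁻²levC_j` for ALL `j ≤ k`, p21 weights `a_j > 0`), the
consumer's explicit matrix `K` on `S = Ω′₀ = □₀` with the dented cells `c.lamS`, ramp length `s ≥ 1`, wall parameter `m_W ≥ 4s`.  Objects as in dag-n05-c's F4b: `uA = (h_A u)(· − t)`
on the host box `X`, `gA = G′·uA` (`G′ = gml`, p21's inverse at the member), its pull-back `gAx`; `uB = h_B u` on the wall `W`, `gB = (K|_W)⁻¹uB`, its extension `gBx` by zero.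
Then at every `x ∈ □₀`: `Σ_{z∈□₀} K(x,z)·(h̃_A(z)·η²gAx(z) + h̃_B(z)·gBx(z)) = u(x) + Σ_{z∈□₀} K(x,z)·((h̃_A(z) − h̃_A(x))·η²gAx(z) + (h̃_B(z) − h̃_B(x))·gBx(z))` — `T·P u = u + K₁u`.
Region A: where `h̃_A(x) ≠ 0` the row of `K` is the row of `η⁻²·mlOp` (the dented G2 `row_eq_mlOp_row`, p673619) and `mlOp·gml = 1`; region B: where `h̃_B(x) ≠ 0`, `x ∈ W` and
`Σ_{z∈W}K(x,z)(K|_W)⁻¹(z,·) = δ_x`. [cite: Balaban1984PropagatorsII, (2.49)–(2.50) p.231–232; Balaban1985RegularSpaces, (1.101) p.93, p.98; Balaban1985Variational, (148)–(151) p.301] -/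
theorem parametrix_identity {ℓ Mh K' : ℕ} {Ω : ℕ → Set (Fin (d + 1) → ℤ)} (hℓ : 1 ≤ ℓ) (hMh2 : 2 ≤ Mh) (c : CubeB8D (d + 1) (ℓ + 1) K' Ω) {R : ℕ}
    (D : B6MultiLevelBoxOperatorL0.Domains d ℓ Mh c.k (boxP ℓ c.M c.ρ c.k c.k) R) (hD : D.lev = levD Mh c)
    {η : ℝ} (hη : η ≠ 0) (w aw : ℕ → ℝ) (hw0 : ∀ j, 0 ≤ w j) (haw : ∀ j, 0 < aw j)
    (hw : ∀ j, j ≤ c.k → w j * (((((ℓ + 1 : ℕ) : ℝ) ^ (d + 1))⁻¹) ^ j) ^ 2 = (η ^ 2)⁻¹ * levC d ℓ aw j)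
    (K : (Fin (d + 1) → ℤ) → (Fin (d + 1) → ℤ) → ℝ)
    (hK : ∀ x z, K x z = ((η ^ 2)⁻¹ * ∑ μ : Fin (d + 1), ((2 : ℝ) * (if z = x then (1 : ℝ) else 0) - (if z = x + e μ then (1 : ℝ) else 0)
        - (if z = x - e μ then (1 : ℝ) else 0))) +
        (∑ j ∈ Finset.range (c.k + 1), (if blockMap ((ℓ + 1) ^ j) x ∈ c.lamS j ∧
            blockMap ((ℓ + 1) ^ j) z = blockMap ((ℓ + 1) ^ j) x then
          w j * (((((ℓ + 1 : ℕ) : ℝ) ^ (d + 1))⁻¹) ^ j) ^ 2 else 0)))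
    (S : Finset (Fin (d + 1) → ℤ)) (hS : ∀ z, z ∈ S ↔ z ∈ c.sq 0)
    {s : ℕ} (hs : 1 ≤ s) {mW : ℕ} (hmW : 4 * s ≤ mW)
    (u : (Fin (d + 1) → ℤ) → ℝ)
    (uA : ↥(boxDom (N0 ℓ Mh c.k (boxP ℓ c.M c.ρ c.k c.k))) → ℝ)
    (huA : ∀ y, uA y = cutA (Nat.succ_pos d) (ℓ + 1) c.a c.M c.ρ c.k s (y.1 - shift ℓ Mh c.a c.ρ c.k c.k) * u (y.1 - shift ℓ Mh c.a c.ρ c.k c.k))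
    (gAx : (Fin (d + 1) → ℤ) → ℝ)
    (hgAx : ∀ y : ↥(boxDom (N0 ℓ Mh c.k (boxP ℓ c.M c.ρ c.k c.k))),
      gAx (y.1 - shift ℓ Mh c.a c.ρ c.k c.k) = (gml (N0 ℓ Mh c.k (boxP ℓ c.M c.ρ c.k c.k)) ℓ c.k (levD Mh c) aw *ᵥ uA) y)
    (uB : ↥(wall (Nat.succ_pos d) (ℓ + 1) c.a c.M c.ρ c.k S mW) → ℝ) (huB : ∀ y, uB y = cutB (Nat.succ_pos d) (ℓ + 1) c.a c.M c.ρ c.k s y.1 * u y.1)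
    (gBx : (Fin (d + 1) → ℤ) → ℝ)
    (hgBx : ∀ y : ↥(wall (Nat.succ_pos d) (ℓ + 1) c.a c.M c.ρ c.k S mW),
      gBx y.1 = ((Matrix.of fun x z : ↥(wall (Nat.succ_pos d) (ℓ + 1) c.a c.M c.ρ c.k S mW) => K x.1 z.1)⁻¹ *ᵥ uB) y)
    (hgBx0 : ∀ z, z ∉ wall (Nat.succ_pos d) (ℓ + 1) c.a c.M c.ρ c.k S mW → gBx z = 0)
    {x : Fin (d + 1) → ℤ} (hx : x ∈ S) :
    ∑ z ∈ S, K x z * (cutAt (Nat.succ_pos d) (ℓ + 1) c.a c.M c.ρ c.k s z * (η ^ 2 * gAx z) + cutBt (Nat.succ_pos d) (ℓ + 1) c.a c.M c.ρ c.k s z * gBx z)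
      = u x + ∑ z ∈ S, K x z * ((cutAt (Nat.succ_pos d) (ℓ + 1) c.a c.M c.ρ c.k s z - cutAt (Nat.succ_pos d) (ℓ + 1) c.a c.M c.ρ c.k s x) * (η ^ 2 * gAx z)
          + (cutBt (Nat.succ_pos d) (ℓ + 1) c.a c.M c.ρ c.k s z - cutBt (Nat.succ_pos d) (ℓ + 1) c.a c.M c.ρ c.k s x) * gBx z) := by
  have hL : 1 ≤ ℓ + 1 := Nat.succ_pos ℓ
  have hk : 1 ≤ c.k := c.one_le_k
  have hρL : ℓ + 1 ≤ c.ρ := c.L_le_ρ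
  have hρ0 : 0 < c.ρ := lt_of_lt_of_le (Nat.succ_pos ℓ) hρL
  have hx0 : x ∈ cube (ℓ + 1) c.a c.M c.ρ c.k 0 := by rw [← c.sq_zero]; exact (hS x).mp hx
  -- REGION A: `h̃_A(x)·Σ_z K(x,z)·η²gAx(z) = h_A(x)u(x)`
  have hA0 : cutAt (Nat.succ_pos d) (ℓ + 1) c.a c.M c.ρ c.k s x * ∑ z ∈ S, K x z * (η ^ 2 * gAx z)
      = cutA (Nat.succ_pos d) (ℓ + 1) c.a c.M c.ρ c.k s x * u x := by
    by_cases h0 : cutAt (Nat.succ_pos d) (ℓ + 1) c.a c.M c.ρ c.k s x = 0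
    · have : cutA (Nat.succ_pos d) (ℓ + 1) c.a c.M c.ρ c.k s x = 0 := by
        rw [← cutAt_mul_cutA (Nat.succ_pos d) (ℓ + 1) c.a c.M c.ρ c.k hs x, h0, zero_mul]
      rw [h0, this, zero_mul, zero_mul]
    · obtain ⟨-, hx1, hxe⟩ := depth_of_cutAt_ne_zero (Nat.succ_pos d) (ℓ + 1) c.a c.M c.ρ c.k hs hk h0
      have hx1' : x ∈ cube (ℓ + 1) c.a c.M c.ρ c.k 0 := cube_anti (Nat.zero_le 1) hk hx1
      have hxe' : ∀ μ, x + e μ ∈ cube (ℓ + 1) c.a c.M c.ρ c.k 0 ∧ x - e μ ∈ cube (ℓ + 1) c.a c.M c.ρ c.k 0 := fun μ =>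
        ⟨cube_anti (Nat.zero_le 1) hk (hxe μ).1, cube_anti (Nat.zero_le 1) hk (hxe μ).2⟩
      have hrow := row_eq_mlOp_row hℓ hMh2 c D hD w aw hw K hK S hS
        ⟨x + shift ℓ Mh c.a c.ρ c.k c.k, mem_boxDom_of_mem_cube_zero hℓ hMh2 c.a c.one_le_k le_rfl hx1'⟩ rfl hx1' hxe' (fun z => η ^ 2 * gAx z)
      have hsum : ∑ y : ↥(boxDom (N0 ℓ Mh c.k (boxP ℓ c.M c.ρ c.k c.k))),
          mlOp (N0 ℓ Mh c.k (boxP ℓ c.M c.ρ c.k c.k)) ℓ c.k (levD Mh c) aw ⟨x + shift ℓ Mh c.a c.ρ c.k c.k, mem_boxDom_of_mem_cube_zero hℓ hMh2 c.a c.one_le_k le_rfl hx1'⟩ y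
            * (η ^ 2 * gAx (y.1 - shift ℓ Mh c.a c.ρ c.k c.k))
          = η ^ 2 * (mlOp (N0 ℓ Mh c.k (boxP ℓ c.M c.ρ c.k c.k)) ℓ c.k (levD Mh c) aw *ᵥ
              (gml (N0 ℓ Mh c.k (boxP ℓ c.M c.ρ c.k c.k)) ℓ c.k (levD Mh c) aw *ᵥ uA))
              ⟨x + shift ℓ Mh c.a c.ρ c.k c.k, mem_boxDom_of_mem_cube_zero hℓ hMh2 c.a c.one_le_k le_rfl hx1'⟩ := by
        rw [Matrix.mulVec, dotProduct, Finset.mul_sum]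
        refine Finset.sum_congr rfl fun y _ => ?_
        rw [hgAx y]; ring
      have hN1 : ∀ i : Fin (d + 1), 1 ≤ N0 ℓ Mh c.k (boxP (d := d) ℓ c.M c.ρ c.k c.k) i := by
        intro i
        simp only [N0, boxP]
        exact Nat.mul_pos (pow_pos hL _) (Nat.mul_pos hL (Nat.mul_pos (by omega) (lt_of_lt_of_le hρ0 (Nat.le_add_right _ _))))
      have hinv : mlOp (N0 ℓ Mh c.k (boxP ℓ c.M c.ρ c.k c.k)) ℓ c.k (levD Mh c) aw *ᵥ
          (gml (N0 ℓ Mh c.k (boxP ℓ c.M c.ρ c.k c.k)) ℓ c.k (levD Mh c) aw *ᵥ uA) = uA := by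
        rw [Matrix.mulVec_mulVec, B6MultiLevelBoxOperator.mlOp_mul_gml hN1 (levD_le Mh c) haw, Matrix.one_mulVec]
      rw [hrow, hsum, hinv, huA]
      dsimp only
      have hη2 : η ^ 2 ≠ 0 := pow_ne_zero 2 hη
      rw [add_shift_sub_shift, show (η ^ 2)⁻¹ * (η ^ 2 * (cutA (Nat.succ_pos d) (ℓ + 1) c.a c.M c.ρ c.k s x * u x))
        = cutA (Nat.succ_pos d) (ℓ + 1) c.a c.M c.ρ c.k s x * u x by field_simp, ← mul_assoc,
        cutAt_mul_cutA (Nat.succ_pos d) (ℓ + 1) c.a c.M c.ρ c.k hs x]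
  -- REGION B: `h̃_B(x)·Σ_z K(x,z)·gBx(z) = h_B(x)u(x)`
  have hB0 : cutBt (Nat.succ_pos d) (ℓ + 1) c.a c.M c.ρ c.k s x * ∑ z ∈ S, K x z * gBx z
      = cutB (Nat.succ_pos d) (ℓ + 1) c.a c.M c.ρ c.k s x * u x := by
    by_cases h0 : cutBt (Nat.succ_pos d) (ℓ + 1) c.a c.M c.ρ c.k s x = 0
    · have : cutB (Nat.succ_pos d) (ℓ + 1) c.a c.M c.ρ c.k s x = 0 := by
        rw [← cutBt_mul_cutB (Nat.succ_pos d) (ℓ + 1) c.a c.M c.ρ c.k hs x, h0, zero_mul]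
      rw [h0, this, zero_mul, zero_mul]
    · obtain ⟨-, hδ⟩ := (cutBt_facts (Nat.succ_pos d) (ℓ + 1) c.a c.M c.ρ c.k hs x).1 h0
      have hxW : x ∈ wall (Nat.succ_pos d) (ℓ + 1) c.a c.M c.ρ c.k S mW := mem_wall_of_depth_le (Nat.succ_pos d) (ℓ + 1) c.a c.M c.ρ c.k S mW hx (by omega)
      have hsub : wall (Nat.succ_pos d) (ℓ + 1) c.a c.M c.ρ c.k S mW ⊆ S := wall_subset (Nat.succ_pos d) (ℓ + 1) c.a c.M c.ρ c.k S mW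
      have h1 : ∑ z ∈ S, K x z * gBx z = ∑ z ∈ wall (Nat.succ_pos d) (ℓ + 1) c.a c.M c.ρ c.k S mW, K x z * gBx z := by
        rw [← Finset.sum_subset hsub (fun z _ hz => by rw [hgBx0 z hz, mul_zero])]
      have h2 : ∑ z ∈ wall (Nat.succ_pos d) (ℓ + 1) c.a c.M c.ρ c.k S mW, K x z * gBx z
          = ((Matrix.of fun x z : ↥(wall (Nat.succ_pos d) (ℓ + 1) c.a c.M c.ρ c.k S mW) => K x.1 z.1) *ᵥ
              ((Matrix.of fun x z : ↥(wall (Nat.succ_pos d) (ℓ + 1) c.a c.M c.ρ c.k S mW) => K x.1 z.1)⁻¹ *ᵥ uB)) ⟨x, hxW⟩ := by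
        rw [Matrix.mulVec, dotProduct, ← Finset.sum_coe_sort (wall (Nat.succ_pos d) (ℓ + 1) c.a c.M c.ρ c.k S mW)]
        refine Finset.sum_congr rfl fun z _ => ?_
        rw [hgBx z, Matrix.of_apply]
      have hTunit : IsUnit (Matrix.of fun x z : ↥(wall (Nat.succ_pos d) (ℓ + 1) c.a c.M c.ρ c.k S mW) => K x.1 z.1) :=
        isUnit_flatMatrix (Nat.succ_pos d) hη (ℓ + 1) c.k c.lamS w hw0 K hK _
      have hTT : (Matrix.of fun x z : ↥(wall (Nat.succ_pos d) (ℓ + 1) c.a c.M c.ρ c.k S mW) => K x.1 z.1)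
          * (Matrix.of fun x z : ↥(wall (Nat.succ_pos d) (ℓ + 1) c.a c.M c.ρ c.k S mW) => K x.1 z.1)⁻¹ = 1 :=
        Matrix.mul_nonsing_inv _ ((Matrix.isUnit_iff_isUnit_det _).mp hTunit)
      rw [h1, h2, Matrix.mulVec_mulVec, hTT, Matrix.one_mulVec, huB]
      dsimp only
      rw [← mul_assoc, cutBt_mul_cutB (Nat.succ_pos d) (ℓ + 1) c.a c.M c.ρ c.k hs x]
  -- assemble
  have hsplit : ∀ z ∈ S, K x z * (cutAt (Nat.succ_pos d) (ℓ + 1) c.a c.M c.ρ c.k s z * (η ^ 2 * gAx z) + cutBt (Nat.succ_pos d) (ℓ + 1) c.a c.M c.ρ c.k s z * gBx z)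
      = (cutAt (Nat.succ_pos d) (ℓ + 1) c.a c.M c.ρ c.k s x * (K x z * (η ^ 2 * gAx z)) + cutBt (Nat.succ_pos d) (ℓ + 1) c.a c.M c.ρ c.k s x * (K x z * gBx z))
        + K x z * ((cutAt (Nat.succ_pos d) (ℓ + 1) c.a c.M c.ρ c.k s z - cutAt (Nat.succ_pos d) (ℓ + 1) c.a c.M c.ρ c.k s x) * (η ^ 2 * gAx z)
          + (cutBt (Nat.succ_pos d) (ℓ + 1) c.a c.M c.ρ c.k s z - cutBt (Nat.succ_pos d) (ℓ + 1) c.a c.M c.ρ c.k s x) * gBx z) := by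
    intro z _; ring
  rw [Finset.sum_congr rfl hsplit, Finset.sum_add_distrib, Finset.sum_add_distrib, ← Finset.mul_sum, ← Finset.mul_sum, hA0, hB0,
    ← add_mul, cutA_add_cutB (Nat.succ_pos d) (ℓ + 1) c.a c.M c.ρ c.k s hx0, one_mul]

/-! ## §2 The input of region A in the `(−2)`-weighted sup norm -/

/-- **REGION A INPUT AND OUTPUT.**  If `u` obeys the consumer's weighted bound `(Lʲη)²|u(z)| ≤ N` on `□_j` (`j ≤ n`), then `uA = (h_Au)(· − t)` obeys r05's
hypothesis `|uA(y)| ≤ (Nη⁻²)·(L^{lev y})⁻²` on the host box (the level of `y` IS the tower level of `y − t`, F1), hence — given the (1.101) package of region A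
(r05's L0 reading at the dented box member, constant `C′`) — `η²|(G′uA)(y)| ≤ C′N` and `η²|(∂_μG′uA)(y)| ≤ C′N·(L^{lev y})⁻¹`.
[cite: Balaban1985RegularSpaces, (1.101) p.93; Balaban1985BackgroundPropagators, Theorem 3.1 (3.42) p.397; Balaban1984PropagatorsII, Prop. 2.2 (2.67) p.234] -/
theorem regionA_bounds {ℓ Mh K' : ℕ} {Ω : ℕ → Set (Fin (d + 1) → ℤ)} (c : CubeB8D (d + 1) (ℓ + 1) K' Ω)
    {η : ℝ} (hη : 0 < η) (aw : ℕ → ℝ) {C' : ℝ}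
    (hG : ∀ (f : ↥(boxDom (N0 ℓ Mh c.k (boxP ℓ c.M c.ρ c.k c.k))) → ℝ) (S' : ℝ), 0 ≤ S' →
      (∀ z : ↥(boxDom (N0 ℓ Mh c.k (boxP ℓ c.M c.ρ c.k c.k))), |f z| ≤ S' * ((((ℓ : ℝ) + 1) ^ levD Mh c z.1) ^ 2)⁻¹) →
      ∀ y : ↥(boxDom (N0 ℓ Mh c.k (boxP ℓ c.M c.ρ c.k c.k))),
        |(gml (N0 ℓ Mh c.k (boxP ℓ c.M c.ρ c.k c.k)) ℓ c.k (levD Mh c) aw *ᵥ f) y| ≤ C' * S' ∧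
        ∀ μ : Fin (d + 1), |(dMat (N0 ℓ Mh c.k (boxP ℓ c.M c.ρ c.k c.k)) μ *ᵥ (gml (N0 ℓ Mh c.k (boxP ℓ c.M c.ρ c.k c.k)) ℓ c.k (levD Mh c) aw *ᵥ f)) y|
          ≤ C' * (((ℓ : ℝ) + 1) ^ levD Mh c y.1)⁻¹ * S')
    {s : ℕ} (hs : 1 ≤ s) (u : (Fin (d + 1) → ℤ) → ℝ) {N : ℝ} (hN : 0 ≤ N)
    (hu : ∀ j, j ≤ c.k → ∀ z, z ∈ c.sq j → ((((ℓ + 1 : ℕ) : ℝ)) ^ j * η) ^ 2 * |u z| ≤ N)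
    (uA : ↥(boxDom (N0 ℓ Mh c.k (boxP ℓ c.M c.ρ c.k c.k))) → ℝ)
    (huA : ∀ y, uA y = cutA (Nat.succ_pos d) (ℓ + 1) c.a c.M c.ρ c.k s (y.1 - shift ℓ Mh c.a c.ρ c.k c.k) * u (y.1 - shift ℓ Mh c.a c.ρ c.k c.k))
    (y : ↥(boxDom (N0 ℓ Mh c.k (boxP ℓ c.M c.ρ c.k c.k)))) :
    η ^ 2 * |(gml (N0 ℓ Mh c.k (boxP ℓ c.M c.ρ c.k c.k)) ℓ c.k (levD Mh c) aw *ᵥ uA) y| ≤ C' * N ∧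
    ∀ μ : Fin (d + 1), η ^ 2 * |(dMat (N0 ℓ Mh c.k (boxP ℓ c.M c.ρ c.k c.k)) μ *ᵥ (gml (N0 ℓ Mh c.k (boxP ℓ c.M c.ρ c.k c.k)) ℓ c.k (levD Mh c) aw *ᵥ uA)) y|
      ≤ C' * N * (((ℓ : ℝ) + 1) ^ levD Mh c y.1)⁻¹ := by
  have hk : 1 ≤ c.k := c.one_le_k
  have hη2 : 0 < η ^ 2 := by positivity
  have hcast : ((ℓ + 1 : ℕ) : ℝ) = (ℓ : ℝ) + 1 := by push_cast; ring
  -- the input bound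
  have huA' : ∀ z : ↥(boxDom (N0 ℓ Mh c.k (boxP ℓ c.M c.ρ c.k c.k))),
      |uA z| ≤ N * (η ^ 2)⁻¹ * ((((ℓ : ℝ) + 1) ^ levD Mh c z.1) ^ 2)⁻¹ := by
    intro z
    rw [huA z]
    by_cases h0 : cutA (Nat.succ_pos d) (ℓ + 1) c.a c.M c.ρ c.k s (z.1 - shift ℓ Mh c.a c.ρ c.k c.k) = 0
    · rw [h0, zero_mul, abs_zero]; positivity
    · have hz1 := mem_cube_one_of_cutA_ne_zero (Nat.succ_pos d) (ℓ + 1) c.a c.M c.ρ hs hk h0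
      have hz0 : z.1 - shift ℓ Mh c.a c.ρ c.k c.k ∈ cube (ℓ + 1) c.a c.M c.ρ c.k 0 := cube_anti (Nat.zero_le 1) hk hz1
      set j₀ := levD Mh c z.1 with hj₀
      have hj₀n : j₀ ≤ c.k := levD_le Mh c _
      have hzt : z.1 - shift ℓ Mh c.a c.ρ c.k c.k + shift ℓ Mh c.a c.ρ c.k c.k = z.1 := sub_add_cancel _ _
      have htower : blockMap ((ℓ + 1) ^ j₀) (z.1 - shift ℓ Mh c.a c.ρ c.k c.k) ∈ c.lamS j₀ := by
        rw [tower_iff_levD_eq c hj₀n hz0 (Mh := Mh), hzt]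
      have hzj : z.1 - shift ℓ Mh c.a c.ρ c.k c.k ∈ c.sq j₀ := mem_sq_of_tower c hj₀n htower
      have hb := hu j₀ hj₀n _ hzj
      rw [hcast] at hb
      have hc := (cut_mem (Nat.succ_pos d) (ℓ + 1) c.a c.M c.ρ c.k s (z.1 - shift ℓ Mh c.a c.ρ c.k c.k)).1
      rw [abs_mul, abs_of_nonneg hc.1]
      have hpow : 0 < (((ℓ : ℝ) + 1) ^ j₀) ^ 2 := by positivity
      calc cutA (Nat.succ_pos d) (ℓ + 1) c.a c.M c.ρ c.k s (z.1 - shift ℓ Mh c.a c.ρ c.k c.k) * |u (z.1 - shift ℓ Mh c.a c.ρ c.k c.k)|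
          ≤ 1 * |u (z.1 - shift ℓ Mh c.a c.ρ c.k c.k)| := mul_le_mul_of_nonneg_right hc.2 (abs_nonneg _)
        _ ≤ N * (η ^ 2)⁻¹ * ((((ℓ : ℝ) + 1) ^ j₀) ^ 2)⁻¹ := by
            rw [one_mul, mul_assoc, ← mul_inv, le_mul_inv_iff₀ (by positivity)]
            calc |u (z.1 - shift ℓ Mh c.a c.ρ c.k c.k)| * (η ^ 2 * (((ℓ : ℝ) + 1) ^ j₀) ^ 2)
                = (((ℓ : ℝ) + 1) ^ j₀ * η) ^ 2 * |u (z.1 - shift ℓ Mh c.a c.ρ c.k c.k)| := by ring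
              _ ≤ N := hb
  obtain ⟨h1, h2⟩ := hG uA (N * (η ^ 2)⁻¹) (by positivity) huA' y
  constructor
  · calc η ^ 2 * |(gml (N0 ℓ Mh c.k (boxP ℓ c.M c.ρ c.k c.k)) ℓ c.k (levD Mh c) aw *ᵥ uA) y|
        ≤ η ^ 2 * (C' * (N * (η ^ 2)⁻¹)) := mul_le_mul_of_nonneg_left h1 hη2.le
      _ = C' * N := by field_simp
  · intro μ
    calc η ^ 2 * |(dMat (N0 ℓ Mh c.k (boxP ℓ c.M c.ρ c.k c.k)) μ *ᵥ (gml (N0 ℓ Mh c.k (boxP ℓ c.M c.ρ c.k c.k)) ℓ c.k (levD Mh c) aw *ᵥ uA)) y|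
        ≤ η ^ 2 * (C' * (((ℓ : ℝ) + 1) ^ levD Mh c y.1)⁻¹ * (N * (η ^ 2)⁻¹)) := mul_le_mul_of_nonneg_left (h2 μ) hη2.le
      _ = C' * N * (((ℓ : ℝ) + 1) ^ levD Mh c y.1)⁻¹ := by field_simp

/-! ## §3 The input and output of region B (the wall) -/

open Classical in
/-- **REGION B OUTPUT.**  With the wall outside `□₂` (`m_W + (d+1)ℓ ≤ ρL`), normalised weights `a′_j ∈ [a₀, 8]` (`2 ≤ a₀ ≤ 8`) and the consumer's weighted
bound on `u`, the wall field `gB = (K|_W)⁻¹(h_Bu)` satisfies `|gB| ≤ (2L²∕a₀)·c₀((2(d+1)L)⁻¹)^{d+1}·N` (F3 `wall_rowBound` at `θ = ½`, `δ′ = 1∕(2(d+1))`).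
[cite: Balaban1985RegularSpaces, (1.101) p.93, p.98; Balaban1984PropagatorsII, p.228, Lemma 2.1 (2.61) p.234] -/
theorem regionB_bound {ℓ K' : ℕ} {Ω : ℕ → Set (Fin (d + 1) → ℤ)} (c : CubeB8D (d + 1) (ℓ + 1) K' Ω)
    {η : ℝ} (hη : η ≠ 0) (w : ℕ → ℝ) (hwpos : ∀ j, 0 < w j)
    (K : (Fin (d + 1) → ℤ) → (Fin (d + 1) → ℤ) → ℝ)
    (hK : ∀ x z, K x z = ((η ^ 2)⁻¹ * ∑ μ : Fin (d + 1), ((2 : ℝ) * (if z = x then (1 : ℝ) else 0) - (if z = x + e μ then (1 : ℝ) else 0)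
        - (if z = x - e μ then (1 : ℝ) else 0))) +
        (∑ j ∈ Finset.range (c.k + 1), (if blockMap ((ℓ + 1) ^ j) x ∈ c.lamS j ∧
            blockMap ((ℓ + 1) ^ j) z = blockMap ((ℓ + 1) ^ j) x then
          w j * (((((ℓ + 1 : ℕ) : ℝ) ^ (d + 1))⁻¹) ^ j) ^ 2 else 0)))
    (S : Finset (Fin (d + 1) → ℤ)) (hS : ∀ z, z ∈ S ↔ z ∈ c.sq 0)
    {a₀ : ℝ} (ha₀ : 2 ≤ a₀) (ha₀8 : a₀ ≤ 8)
    (hlo : ∀ j, j ≤ c.k → a₀ ≤ w j * η ^ 2 * (((ℓ + 1 : ℕ) : ℝ) ^ j) ^ 2 * (((((ℓ + 1 : ℕ) : ℝ)) ^ (d + 1)) ^ j)⁻¹)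
    (hhi : ∀ j, j ≤ c.k → w j * η ^ 2 * (((ℓ + 1 : ℕ) : ℝ) ^ j) ^ 2 * (((((ℓ + 1 : ℕ) : ℝ)) ^ (d + 1)) ^ j)⁻¹ ≤ 8)
    {s mW : ℕ} (hmWρ : (mW : ℤ) + (d + 1 : ℕ) * ((ℓ + 1 : ℕ) - 1 : ℤ) ≤ c.ρ * (ℓ + 1 : ℕ))
    (u : (Fin (d + 1) → ℤ) → ℝ) {N : ℝ} (hN : 0 ≤ N)
    (hu : ∀ j, j ≤ c.k → ∀ z, z ∈ c.sq j → ((((ℓ + 1 : ℕ) : ℝ)) ^ j * η) ^ 2 * |u z| ≤ N)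
    (uB : ↥(wall (Nat.succ_pos d) (ℓ + 1) c.a c.M c.ρ c.k S mW) → ℝ) (huB : ∀ y, uB y = cutB (Nat.succ_pos d) (ℓ + 1) c.a c.M c.ρ c.k s y.1 * u y.1)
    (y : ↥(wall (Nat.succ_pos d) (ℓ + 1) c.a c.M c.ρ c.k S mW)) :
    |(((Matrix.of fun x z : ↥(wall (Nat.succ_pos d) (ℓ + 1) c.a c.M c.ρ c.k S mW) => K x.1 z.1)⁻¹) *ᵥ uB) y|
      ≤ (((ℓ + 1 : ℕ) : ℝ)) ^ 2 / (a₀ * (1 - 1 / 2)) * B6.c0 1 (1 / (2 * ((d : ℝ) + 1)) / ((ℓ + 1 : ℕ) : ℝ)) ^ (d + 1) * N := by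
  have hL : 1 ≤ ℓ + 1 := Nat.succ_pos ℓ
  have hd : 0 < d + 1 := Nat.succ_pos d
  -- the input bound `|uB| ≤ Nη⁻²` (the level-0 reading of the weighted bound on `□₀`)
  have huB' : ∀ z ∈ wall (Nat.succ_pos d) (ℓ + 1) c.a c.M c.ρ c.k S mW, |(fun z => cutB (Nat.succ_pos d) (ℓ + 1) c.a c.M c.ρ c.k s z * u z) z| ≤ N * (η ^ 2)⁻¹ := by
    intro z hz
    have hzS : z ∈ S := wall_subset (Nat.succ_pos d) (ℓ + 1) c.a c.M c.ρ c.k S mW hz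
    have hz0 : z ∈ c.sq 0 := (hS z).mp hzS
    have hb := hu 0 (Nat.zero_le _) z hz0
    rw [pow_zero, one_mul] at hb
    have hc := (cut_mem (Nat.succ_pos d) (ℓ + 1) c.a c.M c.ρ c.k s z).2.2.1
    dsimp only
    rw [abs_mul, abs_of_nonneg hc.1]
    have hη2 : 0 < η ^ 2 := by positivity
    calc cutB (Nat.succ_pos d) (ℓ + 1) c.a c.M c.ρ c.k s z * |u z| ≤ 1 * |u z| := mul_le_mul_of_nonneg_right hc.2 (abs_nonneg _)
      _ ≤ N * (η ^ 2)⁻¹ := by rw [one_mul, le_mul_inv_iff₀ hη2, mul_comm]; exact hb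
  have hrow := wall_rowBound hd hη hL c.k c.lamS w hwpos K hK (wall (Nat.succ_pos d) (ℓ + 1) c.a c.M c.ρ c.k S mW)
    (wall_hfull c hd S hS mW hmWρ) (wall_hdisj c hd S hS mW) (wall_hcover c hd S hS mW)
    (wall_hlow c hd S mW hmWρ) (lt_of_lt_of_le (by norm_num) ha₀) ha₀8 hlo hhi
    (δ' := 1 / (2 * ((d : ℝ) + 1))) (θ := 1 / 2) (by positivity) ?_ ?_ ?_ ?_ (by norm_num)
    (fun z => cutB (Nat.succ_pos d) (ℓ + 1) c.a c.M c.ρ c.k s z * u z) hN huB' y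
  · have heq : ∑ z : ↥(wall (Nat.succ_pos d) (ℓ + 1) c.a c.M c.ρ c.k S mW),
        ((Matrix.of fun x z : ↥(wall (Nat.succ_pos d) (ℓ + 1) c.a c.M c.ρ c.k S mW) => K x.1 z.1)⁻¹) y z
          * (fun z => cutB (Nat.succ_pos d) (ℓ + 1) c.a c.M c.ρ c.k s z * u z) z.1
        = (((Matrix.of fun x z : ↥(wall (Nat.succ_pos d) (ℓ + 1) c.a c.M c.ρ c.k S mW) => K x.1 z.1)⁻¹) *ᵥ uB) y := by
      rw [Matrix.mulVec, dotProduct]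
      exact Finset.sum_congr rfl fun z _ => by rw [huB z]
    rw [← heq]
    have hd1 : ((d + 1 : ℕ) : ℝ) = (d : ℝ) + 1 := by push_cast; ring
    simpa [hd1] using hrow
  -- the four numeric side conditions of brick 3 at `δ′ = 1/(2(d+1))`, `θ = ½`
  · have : (0 : ℝ) < (d : ℝ) + 1 := by positivity
    rw [div_le_one (by positivity)]; linarith
  · have hd1 : ((d + 1 : ℕ) : ℝ) = (d : ℝ) + 1 := by push_cast; ring
    rw [hd1]; field_simp; linarith
  · have hd1 : ((d + 1 : ℕ) : ℝ) = (d : ℝ) + 1 := by push_cast; ring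
    have hD : (1 : ℝ) ≤ (d : ℝ) + 1 := by linarith [Nat.cast_nonneg (α := ℝ) d]
    rw [hd1]
    have : 4 * ((d : ℝ) + 1) * (1 / (2 * ((d : ℝ) + 1))) ^ 2 = 1 / ((d : ℝ) + 1) := by field_simp; ring
    rw [this, div_le_iff₀ (by positivity)]
    nlinarith
  · have hd1 : ((d + 1 : ℕ) : ℝ) = (d : ℝ) + 1 := by push_cast; ring
    rw [hd1]
    have : 2 * ((d : ℝ) + 1) ^ 2 * (1 / (2 * ((d : ℝ) + 1))) ^ 2 = 1 / 2 := by field_simp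
    rw [this]

end Literature.MathematicalPhysics.QuantumFieldTheory.Balaban1983to89.B8Eq1101DentedCubeMemberParametrixIdentity
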